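/-
Copyright (c) 2026 the pub-hodgecm-mathlib formalisation cell (harness21).  Prover seat hodgecm-mathlib-K2E4-p11 (g7), Track B ∕ K2-LIT, h413 = `stmt-HodgeConjecture-24833`,
ENGINE E1, 5Res campaign «ENDGAME BY FAMILIES», RUNG 1, deal (280)(iii) of K2E1-plan (g7): R2-SUPPORT — the Mathlib-only finiteness lemma behind the «S₀-SUPPORTED ATOMS» edition
(R2, K2E4-p23) of ★ `finiteDimensional_inf_iInf_ker_snd` ∕ ★ p860902: a submodule that embeds into `Π b, A b` with image supported on a FINSET `S₀` of indices (each `A b`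
finite-dimensional) is finite-dimensional — no `[Finite ι]` on the index type.
-/
import Mathlib.LinearAlgebra.FiniteDimensional.Lemmas
import Mathlib.LinearAlgebra.Pi
import HarnessLib

/-!
# K2·E1 — `K2E1FinsetSupportedPiFiniteDimensional`: FINSET-SUPPORTED EMBEDDINGS INTO `Π b, A b` HAVE FINITE-DIMENSIONAL SOURCE (R2-support, Mathlib only)

Track B ∕ K2-LIT, crux h413 = `stmt-HodgeConjecture-24833`, route of record `HCCMUnconditional`; cell `hodgecm-mathlib`, squad K2, ENGINE E1; dealer K2E1-plan (g7) (280)(iii), for the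
R2 edition «S₀-SUPPORTED ATOMS» of the RUNG-1 skeleton (K2E4-p23): there the block index `S` is ARBITRARY (all level-`K′` characters), only the finitely many self-dual blocks `b ∈ S₀`
carry non-zero atom spaces `A b` (off `S₀`, `A b = 0`), and the atoms map `x ↦ (fst (U_b x))_b : M →ₗ Π b, A b` is injective on the no-line-mass part `M` by ★ `exhaustion_injective_of_blocks`;
this file supplies the finiteness conclusion WITHOUT `[Finite S]`.  THEOREMS ONLY (no `def`, no `instance`, no notation, no named-fact hypothesis, no `sorry`; default heartbeats);
lane `--supports stmt-HodgeConjecture-24833 --as helper` (count-neutral).  Closes no socket.  Pure linear algebra over any division ring `𝕜` (instantiated at `𝕜 = ℂ` by unification).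

THE ARGUMENT.  For a finset `S₀ ⊆ ι` the restriction `ρ_{S₀} : (Π b, A b) →ₗ (Π b : S₀, A b)`, `f ↦ f|_{S₀}` (`LinearMap.pi (proj ·)`), is injective on the `S₀`-supported functions
`{f | ∀ b ∉ S₀, f b = 0}`, and its target is finite-dimensional (`S₀` finite, each `A b` finite-dimensional); so if `T : H →ₗ Π b, A b` is injective on a submodule `W` and `T w` is
`S₀`-supported for `w ∈ W`, then `ρ_{S₀} ∘ T ∘ W.subtype` is an injective linear map into a finite-dimensional space and `W` is finite-dimensional.  When `A b` is trivial off `S₀`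
(`Subsingleton (A b)`, or `∀ a : A b, a = 0`) the support clause is automatic.
* §1 `pi_proj_eq_zero_of_support`, `injOn_pi_proj_of_support` — (a) the restriction to `S₀` is injective on `S₀`-supported functions; `finiteDimensional_pi_compl_bot` — the submodule
  `Submodule.pi (↑S₀)ᶜ ⊥ = {f | ∀ b ∉ S₀, f b = 0}` of `Π b, A b` is finite-dimensional.
* §2 HEAD **`finiteDimensional_of_injective_of_support`** (submodule form, the dealt bytes) + `…_of_eq_zero` ∕ `…_of_subsingleton` (support automatic off `S₀`).
* §3 `finiteDimensional_of_injective_pi_of_support` ∕ `…_pi_of_subsingleton` — the same with the source a module `M` and `T : M →ₗ Π b, A b` plainly injective (drop-in for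
  `FiniteDimensional.of_injective` in ★ `finiteDimensional_inf_iInf_ker_snd`).
HONEST LABEL: HC_CM is proved only modulo the 7 printed citations (2 remaining named inputs: hLiu418 = `stmt-HodgeConjecture-24832`, h413 = `stmt-HodgeConjecture-24833`) until rung 0
closes; this file asserts no named fact, is unconditional (pure Mathlib linear algebra), and closes no socket; count-neutral.

## References
* [MoeglinWaldspurger1995] C. Mœglin, J.-L. Waldspurger, *Spectral decomposition and Eisenstein series* (1995), V.3.13 (finiteness of the residual spectrum at a fixed level — the use site).
-/

set_option autoImplicit false
-- the mandated namespace repeats the single-problem summit's segment (`HodgeConjecture.HodgeConjecture`)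
set_option linter.dupNamespace false

namespace Summit.HodgeConjecture.HodgeConjecture.Cruxes.H413.K2E1FinsetSupportedPiFiniteDimensional

variable {𝕜 : Type*} [DivisionRing 𝕜] {ι : Type*} {A : ι → Type*} [∀ b, AddCommGroup (A b)] [∀ b, Module 𝕜 (A b)]

/-! ## §1 Restriction to a finset of indices -/

/-- **(a), KERNEL FORM**: an `S₀`-supported `f : Π b, A b` whose restriction to `S₀` vanishes is `0`. [cite: MoeglinWaldspurger1995, V.3.13] -/
theorem pi_proj_eq_zero_of_support (S₀ : Finset ι) (f : ∀ b, A b) (hf : ∀ b, b ∉ S₀ → f b = 0)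
    (h0 : (LinearMap.pi fun b : ↥S₀ => (LinearMap.proj (b : ι) : (∀ i, A i) →ₗ[𝕜] A b)) f = 0) : f = 0 := by
  funext b
  by_cases hb : b ∈ S₀
  · have h := congrFun h0 ⟨b, hb⟩
    simpa only [LinearMap.pi_apply, LinearMap.coe_proj, Function.eval, Pi.zero_apply] using h
  · rw [Pi.zero_apply]
    exact hf b hb

/-- **(a), `InjOn` FORM**: the restriction `(Π b, A b) →ₗ (Π b : S₀, A b)` is injective on the `S₀`-supported functions `{f | ∀ b ∉ S₀, f b = 0}`. [cite: MoeglinWaldspurger1995, V.3.13] -/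
theorem injOn_pi_proj_of_support (S₀ : Finset ι) :
    Set.InjOn (LinearMap.pi fun b : ↥S₀ => (LinearMap.proj (b : ι) : (∀ i, A i) →ₗ[𝕜] A b)) {f : ∀ b, A b | ∀ b, b ∉ S₀ → f b = 0} := by
  intro f hf g hg hfg
  rw [← sub_eq_zero]
  refine pi_proj_eq_zero_of_support (𝕜 := 𝕜) S₀ (f - g) (fun b hb => ?_) ?_
  · rw [Pi.sub_apply, hf b hb, hg b hb, sub_zero]
  · rw [map_sub, hfg, sub_self]

/-- **THE `S₀`-SUPPORTED FUNCTIONS ARE FINITE-DIMENSIONAL**: `Submodule.pi (↑S₀)ᶜ (fun _ ↦ ⊥) = {f | ∀ b ∉ S₀, f b = 0} ≤ Π b, A b` is finite-dimensional when every `A b` (`b ∈ S₀` would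
suffice) is. [cite: MoeglinWaldspurger1995, V.3.13] -/
theorem finiteDimensional_pi_compl_bot [∀ b, FiniteDimensional 𝕜 (A b)] (S₀ : Finset ι) :
    FiniteDimensional 𝕜 ↥(Submodule.pi ((↑S₀ : Set ι)ᶜ) (fun b => (⊥ : Submodule 𝕜 (A b)))) := by
  set W : Submodule 𝕜 (∀ b, A b) := Submodule.pi ((↑S₀ : Set ι)ᶜ) (fun b => (⊥ : Submodule 𝕜 (A b))) with hW
  have hWs : ∀ w ∈ W, ∀ b, b ∉ S₀ → w b = 0 := fun w hw b hb =>
    (Submodule.mem_bot 𝕜).1 ((Submodule.mem_pi).1 hw b (by simpa only [Set.mem_compl_iff, Finset.mem_coe] using hb))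
  let Φ : W →ₗ[𝕜] (∀ b : ↥S₀, A b) := (LinearMap.pi fun b : ↥S₀ => (LinearMap.proj (b : ι) : (∀ i, A i) →ₗ[𝕜] A b)) ∘ₗ W.subtype
  refine FiniteDimensional.of_injective Φ ((injective_iff_map_eq_zero Φ).2 fun w hw => ?_)
  exact Subtype.ext (pi_proj_eq_zero_of_support (𝕜 := 𝕜) S₀ (w : ∀ b, A b) (hWs w w.2) hw)

/-! ## §2 HEAD: injective on `W` with `S₀`-supported image ⟹ `W` finite-dimensional -/

variable {H : Type*} [AddCommGroup H] [Module 𝕜 H]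

/-- **HEAD — FINSET-SUPPORTED EMBEDDING ⟹ FINITE-DIMENSIONAL** (R2-support): `A : ι → Type` modules with every `A b` finite-dimensional, `S₀ : Finset ι`, a submodule `W ≤ H` and a linear
`T : H →ₗ Π b, A b` INJECTIVE ON `W` (`T w = 0 → w = 0` for `w ∈ W`) whose values on `W` are SUPPORTED ON `S₀` (`T w b = 0` for `b ∉ S₀`); then `W` is finite-dimensional — it embeds
by `ρ_{S₀} ∘ T` into the finite-dimensional `Π b : S₀, A b`.  No finiteness of `ι`. [cite: MoeglinWaldspurger1995, V.3.13] -/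
theorem finiteDimensional_of_injective_of_support [∀ b, FiniteDimensional 𝕜 (A b)] (S₀ : Finset ι) (W : Submodule 𝕜 H) (T : H →ₗ[𝕜] (∀ b, A b))
    (hT : ∀ w ∈ W, T w = 0 → w = 0) (hsupp : ∀ w ∈ W, ∀ b, b ∉ S₀ → T w b = 0) : FiniteDimensional 𝕜 ↥W := by
  let Φ : W →ₗ[𝕜] (∀ b : ↥S₀, A b) := (LinearMap.pi fun b : ↥S₀ => (LinearMap.proj (b : ι) : (∀ i, A i) →ₗ[𝕜] A b)) ∘ₗ T ∘ₗ W.subtype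
  refine FiniteDimensional.of_injective Φ ((injective_iff_map_eq_zero Φ).2 fun w hw => ?_)
  exact Subtype.ext (hT w w.2 (pi_proj_eq_zero_of_support (𝕜 := 𝕜) S₀ (T (w : H)) (hsupp w w.2) hw))

/-- **HEAD, `A b = 0` OFF `S₀` (pointwise form)**: if every `a : A b` is `0` for `b ∉ S₀`, the support clause is automatic. [cite: MoeglinWaldspurger1995, V.3.13] -/
theorem finiteDimensional_of_injective_of_eq_zero [∀ b, FiniteDimensional 𝕜 (A b)] (S₀ : Finset ι) (hA0 : ∀ b, b ∉ S₀ → ∀ a : A b, a = 0)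
    (W : Submodule 𝕜 H) (T : H →ₗ[𝕜] (∀ b, A b)) (hT : ∀ w ∈ W, T w = 0 → w = 0) : FiniteDimensional 𝕜 ↥W :=
  finiteDimensional_of_injective_of_support S₀ W T hT fun w _ b hb => hA0 b hb (T w b)

/-- **HEAD, `Subsingleton (A b)` OFF `S₀`**: the support clause is automatic. [cite: MoeglinWaldspurger1995, V.3.13] -/
theorem finiteDimensional_of_injective_of_subsingleton [∀ b, FiniteDimensional 𝕜 (A b)] (S₀ : Finset ι) (hA0 : ∀ b, b ∉ S₀ → Subsingleton (A b))
    (W : Submodule 𝕜 H) (T : H →ₗ[𝕜] (∀ b, A b)) (hT : ∀ w ∈ W, T w = 0 → w = 0) : FiniteDimensional 𝕜 ↥W :=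
  finiteDimensional_of_injective_of_support S₀ W T hT fun w _ b hb => by
    haveI := hA0 b hb
    exact Subsingleton.elim _ _

/-! ## §3 The same with a plainly injective `T : M →ₗ Π b, A b` (drop-in for `FiniteDimensional.of_injective`) -/

variable {M : Type*} [AddCommGroup M] [Module 𝕜 M]

/-- **INJECTIVE + `S₀`-SUPPORTED IMAGE ⟹ FINITE-DIMENSIONAL SOURCE**: `T : M →ₗ Π b, A b` injective with `T x b = 0` for `b ∉ S₀` ⟹ `M` finite-dimensional (`A b` finite-dimensional, `S₀`
a finset, `ι` arbitrary). [cite: MoeglinWaldspurger1995, V.3.13] -/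
theorem finiteDimensional_of_injective_pi_of_support [∀ b, FiniteDimensional 𝕜 (A b)] (S₀ : Finset ι) (T : M →ₗ[𝕜] (∀ b, A b)) (hT : Function.Injective T)
    (hsupp : ∀ x : M, ∀ b, b ∉ S₀ → T x b = 0) : FiniteDimensional 𝕜 M := by
  let Φ : M →ₗ[𝕜] (∀ b : ↥S₀, A b) := (LinearMap.pi fun b : ↥S₀ => (LinearMap.proj (b : ι) : (∀ i, A i) →ₗ[𝕜] A b)) ∘ₗ T
  refine FiniteDimensional.of_injective Φ ((injective_iff_map_eq_zero Φ).2 fun x hx => ?_)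
  exact (injective_iff_map_eq_zero T).1 hT x (pi_proj_eq_zero_of_support (𝕜 := 𝕜) S₀ (T x) (hsupp x) hx)

/-- **INJECTIVE INTO `Π b, A b` WITH `Subsingleton (A b)` OFF `S₀` ⟹ FINITE-DIMENSIONAL SOURCE.** [cite: MoeglinWaldspurger1995, V.3.13] -/
theorem finiteDimensional_of_injective_pi_of_subsingleton [∀ b, FiniteDimensional 𝕜 (A b)] (S₀ : Finset ι) (hA0 : ∀ b, b ∉ S₀ → Subsingleton (A b))
    (T : M →ₗ[𝕜] (∀ b, A b)) (hT : Function.Injective T) : FiniteDimensional 𝕜 M :=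
  finiteDimensional_of_injective_pi_of_support S₀ T hT fun x b hb => by
    haveI := hA0 b hb
    exact Subsingleton.elim _ _

end Summit.HodgeConjecture.HodgeConjecture.Cruxes.H413.K2E1FinsetSupportedPiFiniteDimensional
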